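import Literature.NumberTheory.Automorphic.RestrictedProductBoxes
import Literature.NumberTheory.Automorphic.RestrictedTensorProductAdmissibleProofs
import Literature.NumberTheory.Automorphic.HeckeGelfandTrick
import HarnessLib

/-!
# One slot of a restricted tensor product: local Hecke eigen-scalars are global ones

Topic `NumberTheory/Automorphic`; namespace `Literature.NumberTheory.Automorphic`.  Flath's restricted tensor product
`π ≅ ⊗'_i (ρ i, x₀ i)` of representations of a restricted product `Πʳ i, [G i, K i]` ([Flath 1979, §2 Example 2]; Bump §3.4),
in the tree's predicate form ★ `IsRestrictedTensorProductRep ρ π hx₀ j S₀`.  We prove the «one index» statement every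
unramified Hecke-eigenvalue computation uses (Cartier §IV (4.4); Bump Thm. 3.4.4 ff.):

* `IsRestrictedTensorProductRep.mem_span_slotFixed` — a vector of `W` fixed by the slot-`i₀` compact subgroup
  `ι_{i₀}(K i₀)` is a `k`-linear combination of values `j (extend S m)` whose `i₀`-component `m i₀` is `K i₀`-fixed
  (★ `RestrictedTensorProductAux.mem_span_of_forall_fixed`, the tensor-invariants lemma, at one slot);
* `IsRestrictedTensorProductRep.heckeOperator_comp_mulSingleHom_restrictMultilinear` — on such a value the global double
  coset operator `[K_{i₀} t K_{i₀}]` of `π ∘ ι_{i₀}` acts through the LOCAL operator on the slot: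
  `T (j (extend S m)) = j (extend S (update m i₀ (heckeOperator (ρ i₀) (K i₀) t (m i₀))))`;
* **`IsRestrictedTensorProductRep.heckeOperator_comp_mulSingleHom_apply_eq_smul`** — hence if the local Hecke operator
  `heckeOperator (ρ i₀) (K i₀) t` acts by the scalar `λ` on `(ρ i₀)^{K i₀}`, the global operator
  `heckeOperator (π ∘ mulSingleHom K i₀) (K i₀) t` acts by `λ` on every `ι_{i₀}(K i₀)`-fixed vector of `W`.

This is the abstract form of the tree's GL_n statement `Flath1979_heckeOperatorAt_ofLocal_eq_smul` (`UnramifiedHeckeScalars`),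
for an arbitrary restricted product; it is the slot step S4c-1′ of the cell `hodgecm-mathlib`'s d6 line (A-p05 (g11) census
`CENSUS-D6-S4c-G-moduloS4b3` §S4c-1′).  No named fact, no `sorry`.

## References
* D. Flath, *Decomposition of representations into tensor products*, Corvallis 1979, part 1, 179–183, §2 Example 2 [Flath1979].
* P. Cartier, *Representations of p-adic groups: a survey*, Corvallis 1979, part 1, §IV [CartierCorvallis1979].
* D. Bump, *Automorphic Forms and Representations* (1997), §3.4, Thm. 3.4.4 [Bump1997].
-/

open scoped RestrictedProduct
open MulAction Filter

namespace Literature.NumberTheory.Automorphic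

universe u uk uG v w

variable {ι : Type u} {k : Type uk} [Field k] {G : ι → Type uG} [∀ i, Group (G i)]
  {K : ∀ i, Subgroup (G i)} {V : ι → Type v} [∀ i, AddCommGroup (V i)] [∀ i, Module k (V i)]
  {ρ : ∀ i, Representation k (G i) (V i)} {x₀ : ∀ i, V i} [DecidableEq ι]
  {W : Type w} [AddCommGroup W] [Module k W] {π : Representation k (Πʳ i, [G i, K i]) W}
  {hx₀ : ∀ᶠ i in cofinite, x₀ i ∈ (ρ i).fixedPoints (K i)}
  {j : RestrictedFamily V x₀ → W} {S₀ : Finset ι}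

namespace IsRestrictedTensorProductRep

/-- **Slot-`i₀` invariants.**  If `x ∈ W` is fixed by `π (ι_{i₀} g)` for all `g ∈ K i₀`, then for every finite `S ⊇ S₀`
with `x` in the range of `⨂_{i ∈ S} V i → W`, `x` is a linear combination of values `j (extend S m)` with
`m i ∈ (ρ i₀)^{K i₀}` at the slot `i = i₀` (no condition at the other slots).  One slot of the tensor-invariants lemma
★ `mem_span_of_forall_fixed`. [cite: Flath1979, §2 Example 2] -/
theorem mem_span_slotFixed (h : IsRestrictedTensorProductRep ρ π hx₀ j S₀) (i₀ : ι) {x : W}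
    (hx : x ∈ Representation.fixedPoints (π.comp (mulSingleHom K i₀)) (K i₀)) {S : Finset ι} (hS₀S : S₀ ⊆ S)
    (hxS : x ∈ LinearMap.range (h.isRestrictedTensorProduct.isRestrictedMultilinear.liftFinset S)) :
    x ∈ Submodule.span k (Set.range fun m : (∀ i : S,
        ↥(if (i : ι) = i₀ then (ρ i).fixedPoints (K i) else (⊤ : Submodule k (V i)))) =>
      h.isRestrictedTensorProduct.isRestrictedMultilinear.restrictMultilinear S fun i => (m i : V i)) := by
  classical
  have hj := h.isRestrictedTensorProduct.isRestrictedMultilinear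
  have hinj : Function.Injective (PiTensorProduct.lift (hj.restrictMultilinear S)) :=
    h.isRestrictedTensorProduct.injective_liftFinset hS₀S
  rw [Representation.mem_fixedPoints] at hx
  refine RestrictedTensorProductAux.mem_span_of_forall_fixed (hj.restrictMultilinear S) hinj
    (fun i : S => {e | (i : ι) = i₀ ∧ ∃ g ∈ K (i : ι), e = ρ i g}) _ (fun i y hy => ?_) x hxS ?_
  · by_cases hi : (i : ι) = i₀
    · rw [if_pos hi, Representation.mem_fixedPoints]
      intro g hg
      exact hy _ ⟨hi, g, hg, rfl⟩
    · rw [if_neg hi]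
      exact Submodule.mem_top
  · rintro i e ⟨hi, g, hg, rfl⟩
    refine ⟨π (RestrictedProduct.mulSingle K (i : ι) g), fun m => h.apply_mulSingle_restrictMultilinear S i g m, ?_⟩
    obtain ⟨i, hiS⟩ := i
    subst hi
    exact hx g hg

/-- A value `j (extend S m)` with `K i₀`-fixed slot `m i₀` is fixed by `π (ι_{i₀} (K i₀))`. [cite: Flath1979, §2 Example 2] -/
theorem restrictMultilinear_mem_fixedPoints_comp_mulSingleHom (h : IsRestrictedTensorProductRep ρ π hx₀ j S₀)
    (S : Finset ι) (i : S) (m : ∀ i : S, V i) (hm : m i ∈ (ρ i).fixedPoints (K i)) :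
    h.isRestrictedTensorProduct.isRestrictedMultilinear.restrictMultilinear S m ∈
      Representation.fixedPoints (π.comp (mulSingleHom K (i : ι))) (K i) := by
  rw [Representation.mem_fixedPoints]
  intro g hg
  rw [Representation.mem_fixedPoints] at hm
  rw [MonoidHom.coe_comp, Function.comp_apply, mulSingleHom_apply, h.apply_mulSingle_restrictMultilinear S i g m,
    hm g hg, Function.update_eq_self]

/-- **The global double coset operator acts through the slot.**  For `t ∈ G i₀` with `K_{i₀} t K_{i₀} / K_{i₀}` finite and a
value `j (extend S m)` with `K i₀`-fixed slot `m i₀`: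
`[K_{i₀} t K_{i₀}]_{π ∘ ι_{i₀}} (j (extend S m)) = j (extend S (update m i₀ ([K_{i₀} t K_{i₀}]_{ρ i₀} (m i₀))))`
(the same coset representatives on both sides; multilinearity in the slot). [cite: Flath1979, §2 Example 2]
[cite: CartierCorvallis1979, §IV.1] -/
theorem heckeOperator_comp_mulSingleHom_restrictMultilinear (h : IsRestrictedTensorProductRep ρ π hx₀ j S₀)
    (S : Finset ι) (i : S) (t : G i) (hfin : (orbit (K (i : ι)) (t : G i ⧸ K (i : ι))).Finite)
    (m : ∀ i : S, V i) (hm : m i ∈ (ρ i).fixedPoints (K i)) :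
    heckeOperator (π.comp (mulSingleHom K (i : ι))) (K i) t
        (h.isRestrictedTensorProduct.isRestrictedMultilinear.restrictMultilinear S m) =
      h.isRestrictedTensorProduct.isRestrictedMultilinear.restrictMultilinear S
        (Function.update m i (heckeOperator (ρ i) (K i) t (m i))) := by
  classical
  rw [heckeOperator_apply_eq_sum_out _ _ t hfin (h.restrictMultilinear_mem_fixedPoints_comp_mulSingleHom S i m hm),
    heckeOperator_apply_eq_sum_out _ _ t hfin hm, MultilinearMap.map_update_sum]
  refine Finset.sum_congr rfl fun α _ => ?_
  rw [MonoidHom.coe_comp, Function.comp_apply, mulSingleHom_apply, h.apply_mulSingle_restrictMultilinear S i _ m]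

/-- **One index of a restricted tensor product: a local Hecke eigen-scalar is a global one.**  Let `π ≅ ⊗'_i (ρ i, x₀ i)`
(`IsRestrictedTensorProductRep ρ π hx₀ j S₀`), `i₀ : ι`, `t ∈ G i₀` with `K_{i₀} t K_{i₀} / K_{i₀}` finite, and suppose the local
double coset operator `heckeOperator (ρ i₀) (K i₀) t` acts on `(ρ i₀)^{K i₀}` by the scalar `λ`.  Then
`heckeOperator (π ∘ mulSingleHom K i₀) (K i₀) t` acts by `λ` on every vector of `W` fixed by `π (ι_{i₀} (K i₀))`
(Cartier §IV (4.4): the unramified Hecke algebra at `i₀` acts on `π^{K}` through `(ρ i₀)^{K i₀}`; Bump Thm. 3.4.4 ff.).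
[cite: Flath1979, §2 Example 2] [cite: CartierCorvallis1979, §IV.1] [cite: Bump1997, Thm. 3.4.4] -/
theorem heckeOperator_comp_mulSingleHom_apply_eq_smul (h : IsRestrictedTensorProductRep ρ π hx₀ j S₀) (i₀ : ι)
    (t : G i₀) (c : k) (hloc : ∀ y ∈ (ρ i₀).fixedPoints (K i₀), heckeOperator (ρ i₀) (K i₀) t y = c • y)
    (hfin : (orbit (K i₀) (t : G i₀ ⧸ K i₀)).Finite) {x : W}
    (hx : x ∈ Representation.fixedPoints (π.comp (mulSingleHom K i₀)) (K i₀)) :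
    heckeOperator (π.comp (mulSingleHom K i₀)) (K i₀) t x = c • x := by
  classical
  have hj := h.isRestrictedTensorProduct.isRestrictedMultilinear
  -- `x` comes from a finite level `S ⊇ S₀ ∪ {i₀}`
  obtain ⟨S, hS, hxS⟩ := h.isRestrictedTensorProduct.exists_mem_range_liftFinset (S₀ ∪ {i₀}) x
  have hS₀S : S₀ ⊆ S := fun l hl => hS (Finset.mem_union_left _ hl)
  have hi₀S : i₀ ∈ S := hS (Finset.mem_union_right _ (Finset.mem_singleton_self i₀))
  have hspan := h.mem_span_slotFixed i₀ hx hS₀S hxS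
  -- the operator `T - c` kills every spanning vector
  suffices hle : Submodule.span k (Set.range fun m : (∀ i : S,
        ↥(if (i : ι) = i₀ then (ρ i).fixedPoints (K i) else (⊤ : Submodule k (V i)))) =>
      hj.restrictMultilinear S fun i => (m i : V i)) ≤
      LinearMap.ker (heckeOperator (π.comp (mulSingleHom K i₀)) (K i₀) t - c • LinearMap.id) by
    have := hle hspan
    rwa [LinearMap.mem_ker, LinearMap.sub_apply, LinearMap.smul_apply, LinearMap.id_apply, sub_eq_zero] at this
  refine Submodule.span_le.2 ?_
  rintro _ ⟨m, rfl⟩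
  rw [SetLike.mem_coe, LinearMap.mem_ker, LinearMap.sub_apply, LinearMap.smul_apply, LinearMap.id_apply, sub_eq_zero]
  have hm : ((m ⟨i₀, hi₀S⟩ : V i₀)) ∈ (ρ i₀).fixedPoints (K i₀) := by
    simpa using (m ⟨i₀, hi₀S⟩).2
  rw [h.heckeOperator_comp_mulSingleHom_restrictMultilinear S ⟨i₀, hi₀S⟩ t hfin (fun i => (m i : V i)) hm,
    hloc _ hm, (hj.restrictMultilinear S).map_update_smul, Function.update_eq_self]

end IsRestrictedTensorProductRep

end Literature.NumberTheory.Automorphic
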